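/-
Copyright: cell `pub-balaban-gaps` seat ne6 (gen 10) for the b2b-balaban T⁴-continuum CRUX team, row NE7b OWNER lineage `t4-ne7b-p1`.
Project licence.
-/
import Summits.QuantumFields.BalabanUV.T4Continuum.Spine.NE7b.StabilityWindowSandwich

/-!
# THE RELATIVE-STABILITY SANDWICH: the numerator needs only `V₁ ≥ −(t·x₁ᵀS₁₁x₁ + v⁻)` — stability RELATIVE to the near
# quadratic form — at the price of the upstairs Gaussian `(1−t)·S₁₁`; the window downstairs keeps `S₁₁` (row NE7b, node U5c)

Cell `pub-balaban-gaps` (G2 seat ne6 = row NE7b), typing the OWNER g106's OFFER (RULING W-ne7bp1-g106-1 (B)(4) + ADD1, journal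
l.52967 ∕ l.52973: «`Spine/NE7b/RelativeStabilitySandwich.lean` — first refusal gaps-ne6») in his letters.  [folklore] real analysis
over the OWNER's kernel objects; NOTHING of Bałaban's is named, valued or asserted; no `Support` leaf; no `def`; zero `sorry`.

WHY.  `…NE7b.StabilityWindowSandwich.perturbedMoment_le_of_stability_window` (OWNER g106) asks of the non-quadratic near action
the ABSOLUTE stability `−v⁻ ≤ V₁` on the numerator's support.  Where the numerator of a pinned step lives, the fresh field may be
LARGE on the pinned region, and what the positivity of the action affords there is a bound RELATIVE to the quadratic form, not an
absolute one (the OWNER's ruling: «positivity of the Wilson action gives `V ≥ −S` (relative, not absolute)»; refuter Q-ne7bref-g67-1,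
the SUPPORT clause).  THIS FILE proves the relative form: for any `t : ℝ` (the case of use `0 ≤ t < 1`; the algebra needs no sign) and
**`−(t·x₁ᵀS₁₁x₁ + v⁻) ≤ V₁(x)` on `{F₁ᴺ ≠ 0 ∧ F₂ ≠ 0}`**, the sacrificed fraction `t` of the near form moves UPSTAIRS — the numerator's
fibre hypothesis is stated for the near Gaussian `e^{−((1−t)·x₁ᵀS₁₁x₁ + 2x₁ᵀS₁₂x₂)}` against the window `G₁` with the UNSCALED `S₁₁`
downstairs — and everything else is the OWNER's theorem VERBATIM: SAME far factor `F₂·e^{−V₂}` (so his fibre factorisation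
`restrictedMoment_le_of_shifted_fibres₂` goes through, applied to the tilted sacrificed form `Q₁ + t·S₁₁`), smallness `V₁ ≤ v⁺` on the
window, conclusion `∫ F₁ᴺF₂·e^{Q}·e^{−S}·e^{−V} ≤ e^{v⁻+v⁺}·C·∫ F₁ᴰF₂·e^{−S}·e^{−V}`.  The case `t = 0` is his theorem.  The price of
`t > 0` is paid INSIDE the displayed fibre hypothesis: the upstairs near Gaussian is `(1−t)S₁₁`, so the Gaussian share's domination
letter becomes `Q₁ ≤ δ'·(1−t)S₁₁` and coercivity `(1−t)c₀` (the (R1″)∕Gaussian suppliers read at `S₁₁ ← (1−t)S₁₁`) — displayed, not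
discharged here.

WHAT IS PROVED ([folklore]; the OWNER's `integral_le_of_sandwich₂`, `restrictedMoment_le_of_shifted_fibres₂`, `hfib_window_of_mass`,
`le_mul_exp_neg_of_small` BY NAME; `Matrix.add_mulVec` ∕ `smul_mulVec` algebra):
* §1 `qf_tilt` (`x₁ᵀ(Q₁ + t·S₁₁)x₁ = x₁ᵀQ₁x₁ + t·x₁ᵀS₁₁x₁`), `exp_tilt_shift` (the tilted sacrificed form against the unscaled shifted
  Gaussian IS the untilted one against the `(1−t)`-Gaussian, pointwise), `mul_exp_neg_le_of_relStability`
  (`a ≥ 0`, `a ≠ 0 → −(q + v) ≤ V` ⊢ `a·e^{−V} ≤ e^{v}·(a·e^{q})`).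
* §2 `hfib_tilt` (the displayed `(1−t)`-form fibre hypothesis ⟹ the OWNER's form for the tilted `Q₁ + t·S₁₁`, by `integral_congr`).
* §3 **`perturbedMoment_le_of_relStability_window`** (the statement above) and **`perturbedMoment_le_of_relStability_window_mass`**
  (window mass fraction `η < 1` displayed instead, factor `e^{v⁻+v⁺}·C∕(1−η)`, via his `hfib_window_of_mass` at the tilted form).
NOT HERE (honest): which `t`, `v⁻` the positivity of Bałaban's actions affords on the numerator's support, and whether the Gaussian
suppliers close at `(1−t)S₁₁` with print's letters ((A1c) ∕ (A3) readings, NC-NE7b-α UNRULED); the induced-mean energies behind the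
fibre hypothesis ((R1″)); anything of Bałaban's.  BY-NAME EFFECT ON THE WALL: NONE.  NE7b NOT PRINTED ∕ NOT PROVED; spine PROVED 0∕9;
rung (B)+1 on ONE finite T⁴ — NOT infinite volume, NOT the mass gap, NOT Clay.
HONEST DEPENDENCY: continuum YM on T⁴ ⇐ BetaPertH ∧ nine spine estimates (0∕9 proved); BetaPertH ⇐ (D1) ∧ (D4) ∧ CAP+tail; G-an2-4 gates asym, D1
and NE2∕3∕4.
-/

set_option autoImplicit false

open Matrix Finset MeasureTheory Real
open Summit.QuantumFields.BalabanUV.T4Continuum.NE7b.GaussianBlockDecoupling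
open Summit.QuantumFields.BalabanUV.T4Continuum.NE7b.GaussianFibrewiseDecoupling
open Summit.QuantumFields.BalabanUV.T4Continuum.NE7b.LocalPerturbationSandwich
open Summit.QuantumFields.BalabanUV.T4Continuum.NE7b.StabilityWindowSandwich

namespace Summit.QuantumFields.BalabanUV.T4Continuum.NE7b.RelativeStabilitySandwich

/-! ## §1 The tilt: a fraction `t` of the near form moved into the sacrificed form -/

section Tilt

variable {n₁ n₂ : Type} [Fintype n₁] [Fintype n₂]

omit [Fintype n₂] in
/-- The tilted sacrificed form: `x₁ᵀ(Q₁ + t·S₁₁)x₁ = x₁ᵀQ₁x₁ + t·x₁ᵀS₁₁x₁`. [folklore] -/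
theorem qf_tilt (Q₁ S₁₁ : Matrix n₁ n₁ ℝ) (t : ℝ) (x₁ : n₁ → ℝ) :
    x₁ ⬝ᵥ ((Q₁ + t • S₁₁) *ᵥ x₁) = x₁ ⬝ᵥ (Q₁ *ᵥ x₁) + t * (x₁ ⬝ᵥ (S₁₁ *ᵥ x₁)) := by
  rw [Matrix.add_mulVec, Matrix.smul_mulVec, dotProduct_add, dotProduct_smul, smul_eq_mul]

/-- **THE TILT, POINTWISE**: the tilted sacrificed form against the unscaled shifted Gaussian equals the untilted one against the
`(1−t)`-Gaussian: `e^{x₁ᵀ(Q₁+tS₁₁)x₁}·e^{−(x₁ᵀS₁₁x₁ + b)} = e^{x₁ᵀQ₁x₁}·e^{−((1−t)x₁ᵀS₁₁x₁ + b)}`. [folklore] -/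
theorem exp_tilt_shift (Q₁ S₁₁ : Matrix n₁ n₁ ℝ) (t : ℝ) (x₁ : n₁ → ℝ) (b : ℝ) :
    exp (x₁ ⬝ᵥ ((Q₁ + t • S₁₁) *ᵥ x₁)) * exp (-(x₁ ⬝ᵥ (S₁₁ *ᵥ x₁) + b)) =
      exp (x₁ ⬝ᵥ (Q₁ *ᵥ x₁)) * exp (-((1 - t) * (x₁ ⬝ᵥ (S₁₁ *ᵥ x₁)) + b)) := by
  rw [← exp_add, ← exp_add, qf_tilt]
  ring_nf

omit [Fintype n₁] [Fintype n₂] in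
/-- RELATIVE STABILITY, POINTWISE: for `a ≥ 0` with `a ≠ 0 → −(q + v) ≤ V`, `a·e^{−V} ≤ e^{v}·(a·e^{q})`. [folklore] -/
theorem mul_exp_neg_le_of_relStability {a V q v : ℝ} (ha : 0 ≤ a) (hV : a ≠ 0 → -(q + v) ≤ V) :
    a * exp (-V) ≤ exp v * (a * exp q) := by
  by_cases h0 : a = 0
  · simp [h0]
  · calc a * exp (-V) ≤ a * exp (q + v) := mul_le_mul_of_nonneg_left (exp_le_exp.2 (by linarith [hV h0])) ha
      _ = exp v * (a * exp q) := by rw [exp_add]; ring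

/-! ## §2 The displayed `(1−t)`-form fibre hypothesis feeds the OWNER's form at the tilted sacrificed form -/

/-- **THE TILTED FIBRE HYPOTHESIS**: the numerator's fibre bound stated with the upstairs near Gaussian `(1−t)S₁₁` (and `e^{Q₁}`) against
the window `G₁` with the unscaled `S₁₁` IS the OWNER's `hfib` for the sacrificed form `Q₁ + t·S₁₁`. [folklore] -/
theorem hfib_tilt (S₁₁ Q₁ : Matrix n₁ n₁ ℝ) (S₁₂ : Matrix n₁ n₂ ℝ) (F₁ G₁ : (n₁ → ℝ) → ℝ) (F₂ : (n₂ → ℝ) → ℝ) {C t : ℝ}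
    (hfib : ∀ x₂, F₂ x₂ ≠ 0 →
      ∫ x₁, F₁ x₁ * (exp (x₁ ⬝ᵥ (Q₁ *ᵥ x₁)) * exp (-((1 - t) * (x₁ ⬝ᵥ (S₁₁ *ᵥ x₁)) + 2 * (x₁ ⬝ᵥ (S₁₂ *ᵥ x₂))))) ≤
        C * ∫ x₁, G₁ x₁ * exp (-(x₁ ⬝ᵥ (S₁₁ *ᵥ x₁) + 2 * (x₁ ⬝ᵥ (S₁₂ *ᵥ x₂))))) :
    ∀ x₂, F₂ x₂ ≠ 0 →
      ∫ x₁, F₁ x₁ * (exp (x₁ ⬝ᵥ ((Q₁ + t • S₁₁) *ᵥ x₁)) * exp (-(x₁ ⬝ᵥ (S₁₁ *ᵥ x₁) + 2 * (x₁ ⬝ᵥ (S₁₂ *ᵥ x₂))))) ≤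
        C * ∫ x₁, G₁ x₁ * exp (-(x₁ ⬝ᵥ (S₁₁ *ᵥ x₁) + 2 * (x₁ ⬝ᵥ (S₁₂ *ᵥ x₂)))) := by
  intro x₂ hx₂
  have e : ∀ x₁ : n₁ → ℝ, F₁ x₁ * (exp (x₁ ⬝ᵥ ((Q₁ + t • S₁₁) *ᵥ x₁)) * exp (-(x₁ ⬝ᵥ (S₁₁ *ᵥ x₁) + 2 * (x₁ ⬝ᵥ (S₁₂ *ᵥ x₂))))) =
      F₁ x₁ * (exp (x₁ ⬝ᵥ (Q₁ *ᵥ x₁)) * exp (-((1 - t) * (x₁ ⬝ᵥ (S₁₁ *ᵥ x₁)) + 2 * (x₁ ⬝ᵥ (S₁₂ *ᵥ x₂))))) :=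
    fun x₁ => by rw [exp_tilt_shift]
  simp_rw [e]
  exact hfib x₂ hx₂

end Tilt

/-! ## §3 The perturbed moment from RELATIVE stability on the numerator's support and smallness on a window -/

section RelStability

variable {n₁ n₂ : Type} [Fintype n₁] [Fintype n₂]

/-- **RELATIVE STABILITY ON THE NUMERATOR's SUPPORT, SMALLNESS ON A WINDOW OF THE DENOMINATOR.**  Coupled blocks
`[[S₁₁,S₁₂],[S₁₂ᵀ,S₂₂]]`, sacrificed form `Q₁ ⊕ 0`; numerator near restriction `F₁ᴺ ≥ 0`, denominator near restriction `F₁ᴰ` with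
a window `0 ≤ G₁ ≤ F₁ᴰ`, common far factor `F₂ ≥ 0`; perturbation `V₁(x) + V₂(x₂)`, `V₂` ARBITRARY; `t : ℝ` (no sign needed).  Hypotheses on `V₁`:
RELATIVE STABILITY `−(t·x₁ᵀS₁₁x₁ + v⁻) ≤ V₁ x` where `F₁ᴺ(x₁) ≠ 0 ∧ F₂(x₂) ≠ 0`, SMALLNESS `V₁ x ≤ v⁺` where `G₁(x₁) ≠ 0 ∧ F₂(x₂) ≠ 0`.
If the shifted near-block moments of `F₁ᴺ·e^{Q₁}` UNDER THE `(1−t)`-GAUSSIAN are at most `C ≥ 0` times the shifted masses of the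
window `G₁` under the unscaled one on `{F₂ ≠ 0}`, then `∫ F₁ᴺF₂·e^{Q}·e^{−S}·e^{−V} ≤ e^{v⁻+v⁺}·C·∫ F₁ᴰF₂·e^{−S}·e^{−V}`.  Displayed
integrabilities: the hybrid TILTED numerator (sacrificed form `Q₁ + t·S₁₁`, far part perturbed), the hybrid window mass, the
perturbed denominator — the OWNER's three, the first at the tilted form. [folklore] -/
theorem perturbedMoment_le_of_relStability_window (S₁₁ Q₁ : Matrix n₁ n₁ ℝ) (S₁₂ : Matrix n₁ n₂ ℝ) (S₂₂ : Matrix n₂ n₂ ℝ)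
    (F₁ D₁ G₁ : (n₁ → ℝ) → ℝ) (F₂ : (n₂ → ℝ) → ℝ) (V₁ : (n₁ ⊕ n₂ → ℝ) → ℝ) (V₂ : (n₂ → ℝ) → ℝ) {C t vm vp : ℝ}
    (hF₁ : ∀ x₁, 0 ≤ F₁ x₁) (hG₁ : ∀ x₁, 0 ≤ G₁ x₁) (hGD : ∀ x₁, G₁ x₁ ≤ D₁ x₁) (hF₂ : ∀ x₂, 0 ≤ F₂ x₂) (hC : 0 ≤ C)
    (hstab : ∀ x : n₁ ⊕ n₂ → ℝ, F₁ (fun i => x (Sum.inl i)) ≠ 0 → F₂ (fun i => x (Sum.inr i)) ≠ 0 →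
      -(t * ((fun i => x (Sum.inl i)) ⬝ᵥ (S₁₁ *ᵥ fun i => x (Sum.inl i))) + vm) ≤ V₁ x)
    (hsmall : ∀ x : n₁ ⊕ n₂ → ℝ, G₁ (fun i => x (Sum.inl i)) ≠ 0 → F₂ (fun i => x (Sum.inr i)) ≠ 0 → V₁ x ≤ vp)
    (hA : Integrable fun x : n₁ ⊕ n₂ → ℝ =>
      (F₁ (fun i => x (Sum.inl i)) * (F₂ (fun i => x (Sum.inr i)) * exp (-V₂ (fun i => x (Sum.inr i))))) *
        (exp (x ⬝ᵥ (Matrix.fromBlocks (Q₁ + t • S₁₁) 0 0 (0 : Matrix n₂ n₂ ℝ) *ᵥ x)) *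
          exp (-(x ⬝ᵥ (Matrix.fromBlocks S₁₁ S₁₂ S₁₂ᵀ S₂₂ *ᵥ x)))))
    (hW : Integrable fun x : n₁ ⊕ n₂ → ℝ =>
      (G₁ (fun i => x (Sum.inl i)) * (F₂ (fun i => x (Sum.inr i)) * exp (-V₂ (fun i => x (Sum.inr i))))) *
        exp (-(x ⬝ᵥ (Matrix.fromBlocks S₁₁ S₁₂ S₁₂ᵀ S₂₂ *ᵥ x))))
    (hB' : Integrable fun x : n₁ ⊕ n₂ → ℝ => (D₁ (fun i => x (Sum.inl i)) * F₂ (fun i => x (Sum.inr i))) *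
      (exp (-(x ⬝ᵥ (Matrix.fromBlocks S₁₁ S₁₂ S₁₂ᵀ S₂₂ *ᵥ x))) * exp (-(V₁ x + V₂ (fun i => x (Sum.inr i))))))
    (hfib : ∀ x₂, F₂ x₂ ≠ 0 →
      ∫ x₁, F₁ x₁ * (exp (x₁ ⬝ᵥ (Q₁ *ᵥ x₁)) * exp (-((1 - t) * (x₁ ⬝ᵥ (S₁₁ *ᵥ x₁)) + 2 * (x₁ ⬝ᵥ (S₁₂ *ᵥ x₂))))) ≤
        C * ∫ x₁, G₁ x₁ * exp (-(x₁ ⬝ᵥ (S₁₁ *ᵥ x₁) + 2 * (x₁ ⬝ᵥ (S₁₂ *ᵥ x₂))))) :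
    ∫ x : n₁ ⊕ n₂ → ℝ, (F₁ (fun i => x (Sum.inl i)) * F₂ (fun i => x (Sum.inr i))) *
        ((exp (x ⬝ᵥ (Matrix.fromBlocks Q₁ 0 0 (0 : Matrix n₂ n₂ ℝ) *ᵥ x)) *
          exp (-(x ⬝ᵥ (Matrix.fromBlocks S₁₁ S₁₂ S₁₂ᵀ S₂₂ *ᵥ x)))) * exp (-(V₁ x + V₂ (fun i => x (Sum.inr i))))) ≤
      (exp (vm + vp) * C) * ∫ x : n₁ ⊕ n₂ → ℝ, (D₁ (fun i => x (Sum.inl i)) * F₂ (fun i => x (Sum.inr i))) *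
        (exp (-(x ⬝ᵥ (Matrix.fromBlocks S₁₁ S₁₂ S₁₂ᵀ S₂₂ *ᵥ x))) * exp (-(V₁ x + V₂ (fun i => x (Sum.inr i))))) := by
  have hF₂' : ∀ x₂, 0 ≤ F₂ x₂ * exp (-V₂ x₂) := fun x₂ => mul_nonneg (hF₂ x₂) (exp_pos _).le
  -- the OWNER's fibrewise theorem at the TILTED sacrificed form `Q₁ + t·S₁₁`, far weight `F₂·e^{−V₂}`, window downstairs
  have hmom := restrictedMoment_le_of_shifted_fibres₂ S₁₁ (Q₁ + t • S₁₁) S₁₂ S₂₂ F₁ G₁ (fun x₂ => F₂ x₂ * exp (-V₂ x₂)) hF₂'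
    hA hW (hfib_tilt S₁₁ Q₁ S₁₂ F₁ G₁ (fun x₂ => F₂ x₂ * exp (-V₂ x₂))
      (fun x₂ hx₂ => hfib x₂ (left_ne_zero_of_mul hx₂)))
  refine integral_le_of_sandwich₂ volume hC (fun x => ?_) (fun x => ?_) (fun x => ?_) (fun x => ?_) hA hB' hmom
  · exact mul_nonneg (mul_nonneg (hF₁ _) (hF₂ _)) (mul_nonneg (mul_nonneg (exp_pos _).le (exp_pos _).le) (exp_pos _).le)
  · exact mul_nonneg (mul_nonneg (hG₁ _) (hF₂' _)) (exp_pos _).le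
  · -- numerator, RELATIVE-STABILITY side: `A' = A₀·e^{−V₁} ≤ e^{v⁻}·A₀·e^{t·x₁ᵀS₁₁x₁} = e^{v⁻}·A_t`
    have ha : 0 ≤ (F₁ (fun i => x (Sum.inl i)) * (F₂ (fun i => x (Sum.inr i)) * exp (-V₂ (fun i => x (Sum.inr i))))) *
        (exp (x ⬝ᵥ (Matrix.fromBlocks Q₁ 0 0 (0 : Matrix n₂ n₂ ℝ) *ᵥ x)) *
          exp (-(x ⬝ᵥ (Matrix.fromBlocks S₁₁ S₁₂ S₁₂ᵀ S₂₂ *ᵥ x)))) :=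
      mul_nonneg (mul_nonneg (hF₁ _) (hF₂' _)) (mul_nonneg (exp_pos _).le (exp_pos _).le)
    have hs := mul_exp_neg_le_of_relStability (V := V₁ x) (v := vm)
      (q := t * ((fun i => x (Sum.inl i)) ⬝ᵥ (S₁₁ *ᵥ fun i => x (Sum.inl i)))) ha fun hne => hstab x
      (fun h0 => hne (by rw [h0, zero_mul, zero_mul])) (fun h0 => hne (by rw [h0, zero_mul, mul_zero, zero_mul]))
    have etilt : exp (x ⬝ᵥ (Matrix.fromBlocks (Q₁ + t • S₁₁) 0 0 (0 : Matrix n₂ n₂ ℝ) *ᵥ x)) =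
        exp (x ⬝ᵥ (Matrix.fromBlocks Q₁ 0 0 (0 : Matrix n₂ n₂ ℝ) *ᵥ x)) *
          exp (t * ((fun i => x (Sum.inl i)) ⬝ᵥ (S₁₁ *ᵥ fun i => x (Sum.inl i)))) := by
      rw [qf_fromBlocks_near, qf_fromBlocks_near, qf_tilt, exp_add]
    calc (F₁ (fun i => x (Sum.inl i)) * F₂ (fun i => x (Sum.inr i))) *
          ((exp (x ⬝ᵥ (Matrix.fromBlocks Q₁ 0 0 (0 : Matrix n₂ n₂ ℝ) *ᵥ x)) *
            exp (-(x ⬝ᵥ (Matrix.fromBlocks S₁₁ S₁₂ S₁₂ᵀ S₂₂ *ᵥ x)))) * exp (-(V₁ x + V₂ (fun i => x (Sum.inr i)))))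
        = (F₁ (fun i => x (Sum.inl i)) * (F₂ (fun i => x (Sum.inr i)) * exp (-V₂ (fun i => x (Sum.inr i))))) *
            (exp (x ⬝ᵥ (Matrix.fromBlocks Q₁ 0 0 (0 : Matrix n₂ n₂ ℝ) *ᵥ x)) *
              exp (-(x ⬝ᵥ (Matrix.fromBlocks S₁₁ S₁₂ S₁₂ᵀ S₂₂ *ᵥ x)))) * exp (-V₁ x) := by
          rw [exp_neg_add]; ring
      _ ≤ exp vm * ((F₁ (fun i => x (Sum.inl i)) * (F₂ (fun i => x (Sum.inr i)) * exp (-V₂ (fun i => x (Sum.inr i))))) *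
            (exp (x ⬝ᵥ (Matrix.fromBlocks Q₁ 0 0 (0 : Matrix n₂ n₂ ℝ) *ᵥ x)) *
              exp (-(x ⬝ᵥ (Matrix.fromBlocks S₁₁ S₁₂ S₁₂ᵀ S₂₂ *ᵥ x)))) *
            exp (t * ((fun i => x (Sum.inl i)) ⬝ᵥ (S₁₁ *ᵥ fun i => x (Sum.inl i))))) := hs
      _ = exp vm * ((F₁ (fun i => x (Sum.inl i)) * (F₂ (fun i => x (Sum.inr i)) * exp (-V₂ (fun i => x (Sum.inr i))))) *
            (exp (x ⬝ᵥ (Matrix.fromBlocks (Q₁ + t • S₁₁) 0 0 (0 : Matrix n₂ n₂ ℝ) *ᵥ x)) *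
              exp (-(x ⬝ᵥ (Matrix.fromBlocks S₁₁ S₁₂ S₁₂ᵀ S₂₂ *ᵥ x))))) := by
          rw [etilt]; ring
  · -- window, SMALLNESS side (the OWNER's, verbatim): `W ≤ e^{v⁺}·W·e^{−V₁} ≤ e^{v⁺}·B'` using `G₁ ≤ F₁ᴰ`
    have hb : 0 ≤ (G₁ (fun i => x (Sum.inl i)) * (F₂ (fun i => x (Sum.inr i)) * exp (-V₂ (fun i => x (Sum.inr i))))) *
        exp (-(x ⬝ᵥ (Matrix.fromBlocks S₁₁ S₁₂ S₁₂ᵀ S₂₂ *ᵥ x))) := mul_nonneg (mul_nonneg (hG₁ _) (hF₂' _)) (exp_pos _).le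
    have hs := le_mul_exp_neg_of_small (V := V₁ x) (v := vp) hb fun hne => hsmall x
      (fun h0 => hne (by rw [h0, zero_mul, zero_mul])) (fun h0 => hne (by rw [h0, zero_mul, mul_zero, zero_mul]))
    have hrest : 0 ≤ (F₂ (fun i => x (Sum.inr i)) * exp (-V₂ (fun i => x (Sum.inr i)))) *
        exp (-(x ⬝ᵥ (Matrix.fromBlocks S₁₁ S₁₂ S₁₂ᵀ S₂₂ *ᵥ x))) * exp (-V₁ x) :=
      mul_nonneg (mul_nonneg (hF₂' _) (exp_pos _).le) (exp_pos _).le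
    calc (G₁ (fun i => x (Sum.inl i)) * (F₂ (fun i => x (Sum.inr i)) * exp (-V₂ (fun i => x (Sum.inr i))))) *
          exp (-(x ⬝ᵥ (Matrix.fromBlocks S₁₁ S₁₂ S₁₂ᵀ S₂₂ *ᵥ x)))
        ≤ exp vp * ((G₁ (fun i => x (Sum.inl i)) * (F₂ (fun i => x (Sum.inr i)) * exp (-V₂ (fun i => x (Sum.inr i))))) *
            exp (-(x ⬝ᵥ (Matrix.fromBlocks S₁₁ S₁₂ S₁₂ᵀ S₂₂ *ᵥ x))) * exp (-V₁ x)) := hs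
      _ = exp vp * (G₁ (fun i => x (Sum.inl i)) * ((F₂ (fun i => x (Sum.inr i)) * exp (-V₂ (fun i => x (Sum.inr i)))) *
            exp (-(x ⬝ᵥ (Matrix.fromBlocks S₁₁ S₁₂ S₁₂ᵀ S₂₂ *ᵥ x))) * exp (-V₁ x))) := by ring
      _ ≤ exp vp * (D₁ (fun i => x (Sum.inl i)) * ((F₂ (fun i => x (Sum.inr i)) * exp (-V₂ (fun i => x (Sum.inr i)))) *
            exp (-(x ⬝ᵥ (Matrix.fromBlocks S₁₁ S₁₂ S₁₂ᵀ S₂₂ *ᵥ x))) * exp (-V₁ x))) :=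
          mul_le_mul_of_nonneg_left (mul_le_mul_of_nonneg_right (hGD _) hrest) (exp_pos _).le
      _ = exp vp * ((D₁ (fun i => x (Sum.inl i)) * F₂ (fun i => x (Sum.inr i))) *
            (exp (-(x ⬝ᵥ (Matrix.fromBlocks S₁₁ S₁₂ S₁₂ᵀ S₂₂ *ᵥ x))) * exp (-(V₁ x + V₂ (fun i => x (Sum.inr i)))))) := by
          rw [exp_neg_add]; ring

/-- **THE SAME WITH THE WINDOW's MASS FRACTION DISPLAYED**: the tilted fibre hypothesis against the denominator restriction `F₁ᴰ`
(constant `C`) and, per far configuration, the window's complement carrying at most the fraction `η < 1` of the shifted `F₁ᴰ`-mass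
(unscaled Gaussian) ⟹ factor `e^{v⁻+v⁺}·C∕(1−η)` (the OWNER's `hfib_window_of_mass` at the tilted form). [folklore] -/
theorem perturbedMoment_le_of_relStability_window_mass (S₁₁ Q₁ : Matrix n₁ n₁ ℝ) (S₁₂ : Matrix n₁ n₂ ℝ) (S₂₂ : Matrix n₂ n₂ ℝ)
    (F₁ D₁ G₁ : (n₁ → ℝ) → ℝ) (F₂ : (n₂ → ℝ) → ℝ) (V₁ : (n₁ ⊕ n₂ → ℝ) → ℝ) (V₂ : (n₂ → ℝ) → ℝ) {C η t vm vp : ℝ}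
    (hF₁ : ∀ x₁, 0 ≤ F₁ x₁) (hG₁ : ∀ x₁, 0 ≤ G₁ x₁) (hGD : ∀ x₁, G₁ x₁ ≤ D₁ x₁) (hF₂ : ∀ x₂, 0 ≤ F₂ x₂) (hC : 0 ≤ C)
    (hη : η < 1)
    (hstab : ∀ x : n₁ ⊕ n₂ → ℝ, F₁ (fun i => x (Sum.inl i)) ≠ 0 → F₂ (fun i => x (Sum.inr i)) ≠ 0 →
      -(t * ((fun i => x (Sum.inl i)) ⬝ᵥ (S₁₁ *ᵥ fun i => x (Sum.inl i))) + vm) ≤ V₁ x)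
    (hsmall : ∀ x : n₁ ⊕ n₂ → ℝ, G₁ (fun i => x (Sum.inl i)) ≠ 0 → F₂ (fun i => x (Sum.inr i)) ≠ 0 → V₁ x ≤ vp)
    (hA : Integrable fun x : n₁ ⊕ n₂ → ℝ =>
      (F₁ (fun i => x (Sum.inl i)) * (F₂ (fun i => x (Sum.inr i)) * exp (-V₂ (fun i => x (Sum.inr i))))) *
        (exp (x ⬝ᵥ (Matrix.fromBlocks (Q₁ + t • S₁₁) 0 0 (0 : Matrix n₂ n₂ ℝ) *ᵥ x)) *
          exp (-(x ⬝ᵥ (Matrix.fromBlocks S₁₁ S₁₂ S₁₂ᵀ S₂₂ *ᵥ x)))))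
    (hW : Integrable fun x : n₁ ⊕ n₂ → ℝ =>
      (G₁ (fun i => x (Sum.inl i)) * (F₂ (fun i => x (Sum.inr i)) * exp (-V₂ (fun i => x (Sum.inr i))))) *
        exp (-(x ⬝ᵥ (Matrix.fromBlocks S₁₁ S₁₂ S₁₂ᵀ S₂₂ *ᵥ x))))
    (hB' : Integrable fun x : n₁ ⊕ n₂ → ℝ => (D₁ (fun i => x (Sum.inl i)) * F₂ (fun i => x (Sum.inr i))) *
      (exp (-(x ⬝ᵥ (Matrix.fromBlocks S₁₁ S₁₂ S₁₂ᵀ S₂₂ *ᵥ x))) * exp (-(V₁ x + V₂ (fun i => x (Sum.inr i))))))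
    (hfib : ∀ x₂, F₂ x₂ ≠ 0 →
      ∫ x₁, F₁ x₁ * (exp (x₁ ⬝ᵥ (Q₁ *ᵥ x₁)) * exp (-((1 - t) * (x₁ ⬝ᵥ (S₁₁ *ᵥ x₁)) + 2 * (x₁ ⬝ᵥ (S₁₂ *ᵥ x₂))))) ≤
        C * ∫ x₁, D₁ x₁ * exp (-(x₁ ⬝ᵥ (S₁₁ *ᵥ x₁) + 2 * (x₁ ⬝ᵥ (S₁₂ *ᵥ x₂)))))
    (hmass : ∀ x₂, F₂ x₂ ≠ 0 →
      (∫ x₁, D₁ x₁ * exp (-(x₁ ⬝ᵥ (S₁₁ *ᵥ x₁) + 2 * (x₁ ⬝ᵥ (S₁₂ *ᵥ x₂))))) -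
          ∫ x₁, G₁ x₁ * exp (-(x₁ ⬝ᵥ (S₁₁ *ᵥ x₁) + 2 * (x₁ ⬝ᵥ (S₁₂ *ᵥ x₂)))) ≤
        η * ∫ x₁, D₁ x₁ * exp (-(x₁ ⬝ᵥ (S₁₁ *ᵥ x₁) + 2 * (x₁ ⬝ᵥ (S₁₂ *ᵥ x₂))))) :
    ∫ x : n₁ ⊕ n₂ → ℝ, (F₁ (fun i => x (Sum.inl i)) * F₂ (fun i => x (Sum.inr i))) *
        ((exp (x ⬝ᵥ (Matrix.fromBlocks Q₁ 0 0 (0 : Matrix n₂ n₂ ℝ) *ᵥ x)) *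
          exp (-(x ⬝ᵥ (Matrix.fromBlocks S₁₁ S₁₂ S₁₂ᵀ S₂₂ *ᵥ x)))) * exp (-(V₁ x + V₂ (fun i => x (Sum.inr i))))) ≤
      (exp (vm + vp) * (C / (1 - η))) * ∫ x : n₁ ⊕ n₂ → ℝ, (D₁ (fun i => x (Sum.inl i)) * F₂ (fun i => x (Sum.inr i))) *
        (exp (-(x ⬝ᵥ (Matrix.fromBlocks S₁₁ S₁₂ S₁₂ᵀ S₂₂ *ᵥ x))) * exp (-(V₁ x + V₂ (fun i => x (Sum.inr i))))) := by
  -- the window step is real arithmetic per fibre (the OWNER's `le_window_of_mass`), insensitive to the upstairs form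
  refine perturbedMoment_le_of_relStability_window S₁₁ Q₁ S₁₂ S₂₂ F₁ D₁ G₁ F₂ V₁ V₂ hF₁ hG₁ hGD hF₂
    (div_nonneg hC (sub_pos.2 hη).le) hstab hsmall hA hW hB' fun x₂ hx₂ => ?_
  exact le_window_of_mass hC hη (hfib x₂ hx₂) (hmass x₂ hx₂)

end RelStability

/-! ## §4 (v2, APPENDED after p365113 ✓; refuter σ-ne7bref-g68-1 (a)) The MATRIX tilt: any form `T` — localisable on the pinned region —
replaces `t·S₁₁`: `qf_tiltForm`, `exp_tiltForm_shift`, `hfib_tiltForm`, `perturbedMoment_le_of_relStabilityForm_window` (numerator letter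
`−(x₁ᵀTx₁ + v⁻) ≤ V₁`, upstairs Gaussian `S₁₁ − T`, no hypothesis on `T`; a LOCAL tilt's induced energy is `B₀`-class, buffered, instead of a
far-uniform interface price — κ-ne7bref-g68-2).  §§1–3 and the module docstring above are the landed bytes, byte-identical. -/

section RelStabilityForm

variable {n₁ n₂ : Type} [Fintype n₁] [Fintype n₂]

omit [Fintype n₂] in
/-- The form-tilted sacrificed form: `x₁ᵀ(Q₁ + T)x₁ = x₁ᵀQ₁x₁ + x₁ᵀTx₁`. [folklore] -/
theorem qf_tiltForm (Q₁ T : Matrix n₁ n₁ ℝ) (x₁ : n₁ → ℝ) :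
    x₁ ⬝ᵥ ((Q₁ + T) *ᵥ x₁) = x₁ ⬝ᵥ (Q₁ *ᵥ x₁) + x₁ ⬝ᵥ (T *ᵥ x₁) := by
  rw [Matrix.add_mulVec, dotProduct_add]

omit [Fintype n₂] in
/-- **THE FORM TILT, POINTWISE**: `e^{x₁ᵀ(Q₁+T)x₁}·e^{−(x₁ᵀS₁₁x₁ + b)} = e^{x₁ᵀQ₁x₁}·e^{−(x₁ᵀ(S₁₁−T)x₁ + b)}`. [folklore] -/
theorem exp_tiltForm_shift (Q₁ S₁₁ T : Matrix n₁ n₁ ℝ) (x₁ : n₁ → ℝ) (b : ℝ) :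
    exp (x₁ ⬝ᵥ ((Q₁ + T) *ᵥ x₁)) * exp (-(x₁ ⬝ᵥ (S₁₁ *ᵥ x₁) + b)) =
      exp (x₁ ⬝ᵥ (Q₁ *ᵥ x₁)) * exp (-(x₁ ⬝ᵥ ((S₁₁ - T) *ᵥ x₁) + b)) := by
  rw [← exp_add, ← exp_add, qf_tiltForm, Matrix.sub_mulVec, dotProduct_sub]
  ring_nf

/-- **THE FORM-TILTED FIBRE HYPOTHESIS**: the numerator's fibre bound with the upstairs near Gaussian `S₁₁ − T` (and `e^{Q₁}`) against the
window `G₁` with the unscaled `S₁₁` IS the OWNER's `hfib` for the sacrificed form `Q₁ + T`. [folklore] -/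
theorem hfib_tiltForm (S₁₁ Q₁ T : Matrix n₁ n₁ ℝ) (S₁₂ : Matrix n₁ n₂ ℝ) (F₁ G₁ : (n₁ → ℝ) → ℝ) (F₂ : (n₂ → ℝ) → ℝ) {C : ℝ}
    (hfib : ∀ x₂, F₂ x₂ ≠ 0 →
      ∫ x₁, F₁ x₁ * (exp (x₁ ⬝ᵥ (Q₁ *ᵥ x₁)) * exp (-(x₁ ⬝ᵥ ((S₁₁ - T) *ᵥ x₁) + 2 * (x₁ ⬝ᵥ (S₁₂ *ᵥ x₂))))) ≤
        C * ∫ x₁, G₁ x₁ * exp (-(x₁ ⬝ᵥ (S₁₁ *ᵥ x₁) + 2 * (x₁ ⬝ᵥ (S₁₂ *ᵥ x₂))))) :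
    ∀ x₂, F₂ x₂ ≠ 0 →
      ∫ x₁, F₁ x₁ * (exp (x₁ ⬝ᵥ ((Q₁ + T) *ᵥ x₁)) * exp (-(x₁ ⬝ᵥ (S₁₁ *ᵥ x₁) + 2 * (x₁ ⬝ᵥ (S₁₂ *ᵥ x₂))))) ≤
        C * ∫ x₁, G₁ x₁ * exp (-(x₁ ⬝ᵥ (S₁₁ *ᵥ x₁) + 2 * (x₁ ⬝ᵥ (S₁₂ *ᵥ x₂)))) := by
  intro x₂ hx₂
  have e : ∀ x₁ : n₁ → ℝ, F₁ x₁ * (exp (x₁ ⬝ᵥ ((Q₁ + T) *ᵥ x₁)) * exp (-(x₁ ⬝ᵥ (S₁₁ *ᵥ x₁) + 2 * (x₁ ⬝ᵥ (S₁₂ *ᵥ x₂))))) =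
      F₁ x₁ * (exp (x₁ ⬝ᵥ (Q₁ *ᵥ x₁)) * exp (-(x₁ ⬝ᵥ ((S₁₁ - T) *ᵥ x₁) + 2 * (x₁ ⬝ᵥ (S₁₂ *ᵥ x₂))))) :=
    fun x₁ => by rw [exp_tiltForm_shift]
  simp_rw [e]
  exact hfib x₂ hx₂

/-- **RELATIVE STABILITY AGAINST A FORM** (refuter σ-ne7bref-g68-1 (a): the tilt LOCALISABLE on the pinned region).  As
`perturbedMoment_le_of_relStability_window` with the scalar tilt `t·S₁₁` replaced by ANY matrix `T` (no hypothesis on `T`; the case of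
use: `T` positive semidefinite, living on the pinned region, `T ≤ t·S₁₁`): numerator letter `−(x₁ᵀTx₁ + v⁻) ≤ V₁(x)` on
`{F₁ᴺ ≠ 0 ∧ F₂ ≠ 0}`, hybrid numerator integrability at the sacrificed form `Q₁ + T`, fibre hypothesis displayed with the upstairs near
Gaussian `S₁₁ − T` against the window with `S₁₁`; conclusion the OWNER's, verbatim.  The induced energy of a LOCAL `T` is then
`B₀`-class (buffered, (R1″) suppliers) instead of a far-uniform interface price. [folklore] -/
theorem perturbedMoment_le_of_relStabilityForm_window (S₁₁ Q₁ T : Matrix n₁ n₁ ℝ) (S₁₂ : Matrix n₁ n₂ ℝ) (S₂₂ : Matrix n₂ n₂ ℝ)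
    (F₁ D₁ G₁ : (n₁ → ℝ) → ℝ) (F₂ : (n₂ → ℝ) → ℝ) (V₁ : (n₁ ⊕ n₂ → ℝ) → ℝ) (V₂ : (n₂ → ℝ) → ℝ) {C vm vp : ℝ}
    (hF₁ : ∀ x₁, 0 ≤ F₁ x₁) (hG₁ : ∀ x₁, 0 ≤ G₁ x₁) (hGD : ∀ x₁, G₁ x₁ ≤ D₁ x₁) (hF₂ : ∀ x₂, 0 ≤ F₂ x₂) (hC : 0 ≤ C)
    (hstab : ∀ x : n₁ ⊕ n₂ → ℝ, F₁ (fun i => x (Sum.inl i)) ≠ 0 → F₂ (fun i => x (Sum.inr i)) ≠ 0 →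
      -(((fun i => x (Sum.inl i)) ⬝ᵥ (T *ᵥ fun i => x (Sum.inl i))) + vm) ≤ V₁ x)
    (hsmall : ∀ x : n₁ ⊕ n₂ → ℝ, G₁ (fun i => x (Sum.inl i)) ≠ 0 → F₂ (fun i => x (Sum.inr i)) ≠ 0 → V₁ x ≤ vp)
    (hA : Integrable fun x : n₁ ⊕ n₂ → ℝ =>
      (F₁ (fun i => x (Sum.inl i)) * (F₂ (fun i => x (Sum.inr i)) * exp (-V₂ (fun i => x (Sum.inr i))))) *
        (exp (x ⬝ᵥ (Matrix.fromBlocks (Q₁ + T) 0 0 (0 : Matrix n₂ n₂ ℝ) *ᵥ x)) *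
          exp (-(x ⬝ᵥ (Matrix.fromBlocks S₁₁ S₁₂ S₁₂ᵀ S₂₂ *ᵥ x)))))
    (hW : Integrable fun x : n₁ ⊕ n₂ → ℝ =>
      (G₁ (fun i => x (Sum.inl i)) * (F₂ (fun i => x (Sum.inr i)) * exp (-V₂ (fun i => x (Sum.inr i))))) *
        exp (-(x ⬝ᵥ (Matrix.fromBlocks S₁₁ S₁₂ S₁₂ᵀ S₂₂ *ᵥ x))))
    (hB' : Integrable fun x : n₁ ⊕ n₂ → ℝ => (D₁ (fun i => x (Sum.inl i)) * F₂ (fun i => x (Sum.inr i))) *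
      (exp (-(x ⬝ᵥ (Matrix.fromBlocks S₁₁ S₁₂ S₁₂ᵀ S₂₂ *ᵥ x))) * exp (-(V₁ x + V₂ (fun i => x (Sum.inr i))))))
    (hfib : ∀ x₂, F₂ x₂ ≠ 0 →
      ∫ x₁, F₁ x₁ * (exp (x₁ ⬝ᵥ (Q₁ *ᵥ x₁)) * exp (-(x₁ ⬝ᵥ ((S₁₁ - T) *ᵥ x₁) + 2 * (x₁ ⬝ᵥ (S₁₂ *ᵥ x₂))))) ≤
        C * ∫ x₁, G₁ x₁ * exp (-(x₁ ⬝ᵥ (S₁₁ *ᵥ x₁) + 2 * (x₁ ⬝ᵥ (S₁₂ *ᵥ x₂))))) :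
    ∫ x : n₁ ⊕ n₂ → ℝ, (F₁ (fun i => x (Sum.inl i)) * F₂ (fun i => x (Sum.inr i))) *
        ((exp (x ⬝ᵥ (Matrix.fromBlocks Q₁ 0 0 (0 : Matrix n₂ n₂ ℝ) *ᵥ x)) *
          exp (-(x ⬝ᵥ (Matrix.fromBlocks S₁₁ S₁₂ S₁₂ᵀ S₂₂ *ᵥ x)))) * exp (-(V₁ x + V₂ (fun i => x (Sum.inr i))))) ≤
      (exp (vm + vp) * C) * ∫ x : n₁ ⊕ n₂ → ℝ, (D₁ (fun i => x (Sum.inl i)) * F₂ (fun i => x (Sum.inr i))) *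
        (exp (-(x ⬝ᵥ (Matrix.fromBlocks S₁₁ S₁₂ S₁₂ᵀ S₂₂ *ᵥ x))) * exp (-(V₁ x + V₂ (fun i => x (Sum.inr i))))) := by
  have hF₂' : ∀ x₂, 0 ≤ F₂ x₂ * exp (-V₂ x₂) := fun x₂ => mul_nonneg (hF₂ x₂) (exp_pos _).le
  have hmom := restrictedMoment_le_of_shifted_fibres₂ S₁₁ (Q₁ + T) S₁₂ S₂₂ F₁ G₁ (fun x₂ => F₂ x₂ * exp (-V₂ x₂)) hF₂'
    hA hW (hfib_tiltForm S₁₁ Q₁ T S₁₂ F₁ G₁ (fun x₂ => F₂ x₂ * exp (-V₂ x₂))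
      (fun x₂ hx₂ => hfib x₂ (left_ne_zero_of_mul hx₂)))
  refine integral_le_of_sandwich₂ volume hC (fun x => ?_) (fun x => ?_) (fun x => ?_) (fun x => ?_) hA hB' hmom
  · exact mul_nonneg (mul_nonneg (hF₁ _) (hF₂ _)) (mul_nonneg (mul_nonneg (exp_pos _).le (exp_pos _).le) (exp_pos _).le)
  · exact mul_nonneg (mul_nonneg (hG₁ _) (hF₂' _)) (exp_pos _).le
  · have ha : 0 ≤ (F₁ (fun i => x (Sum.inl i)) * (F₂ (fun i => x (Sum.inr i)) * exp (-V₂ (fun i => x (Sum.inr i))))) *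
        (exp (x ⬝ᵥ (Matrix.fromBlocks Q₁ 0 0 (0 : Matrix n₂ n₂ ℝ) *ᵥ x)) *
          exp (-(x ⬝ᵥ (Matrix.fromBlocks S₁₁ S₁₂ S₁₂ᵀ S₂₂ *ᵥ x)))) :=
      mul_nonneg (mul_nonneg (hF₁ _) (hF₂' _)) (mul_nonneg (exp_pos _).le (exp_pos _).le)
    have hs := mul_exp_neg_le_of_relStability (V := V₁ x) (v := vm)
      (q := (fun i => x (Sum.inl i)) ⬝ᵥ (T *ᵥ fun i => x (Sum.inl i))) ha fun hne => hstab x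
      (fun h0 => hne (by rw [h0, zero_mul, zero_mul])) (fun h0 => hne (by rw [h0, zero_mul, mul_zero, zero_mul]))
    have etilt : exp (x ⬝ᵥ (Matrix.fromBlocks (Q₁ + T) 0 0 (0 : Matrix n₂ n₂ ℝ) *ᵥ x)) =
        exp (x ⬝ᵥ (Matrix.fromBlocks Q₁ 0 0 (0 : Matrix n₂ n₂ ℝ) *ᵥ x)) *
          exp ((fun i => x (Sum.inl i)) ⬝ᵥ (T *ᵥ fun i => x (Sum.inl i))) := by
      rw [qf_fromBlocks_near, qf_fromBlocks_near, qf_tiltForm, exp_add]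
    calc (F₁ (fun i => x (Sum.inl i)) * F₂ (fun i => x (Sum.inr i))) *
          ((exp (x ⬝ᵥ (Matrix.fromBlocks Q₁ 0 0 (0 : Matrix n₂ n₂ ℝ) *ᵥ x)) *
            exp (-(x ⬝ᵥ (Matrix.fromBlocks S₁₁ S₁₂ S₁₂ᵀ S₂₂ *ᵥ x)))) * exp (-(V₁ x + V₂ (fun i => x (Sum.inr i)))))
        = (F₁ (fun i => x (Sum.inl i)) * (F₂ (fun i => x (Sum.inr i)) * exp (-V₂ (fun i => x (Sum.inr i))))) *
            (exp (x ⬝ᵥ (Matrix.fromBlocks Q₁ 0 0 (0 : Matrix n₂ n₂ ℝ) *ᵥ x)) *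
              exp (-(x ⬝ᵥ (Matrix.fromBlocks S₁₁ S₁₂ S₁₂ᵀ S₂₂ *ᵥ x)))) * exp (-V₁ x) := by
          rw [exp_neg_add]; ring
      _ ≤ exp vm * ((F₁ (fun i => x (Sum.inl i)) * (F₂ (fun i => x (Sum.inr i)) * exp (-V₂ (fun i => x (Sum.inr i))))) *
            (exp (x ⬝ᵥ (Matrix.fromBlocks Q₁ 0 0 (0 : Matrix n₂ n₂ ℝ) *ᵥ x)) *
              exp (-(x ⬝ᵥ (Matrix.fromBlocks S₁₁ S₁₂ S₁₂ᵀ S₂₂ *ᵥ x)))) *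
            exp ((fun i => x (Sum.inl i)) ⬝ᵥ (T *ᵥ fun i => x (Sum.inl i)))) := hs
      _ = exp vm * ((F₁ (fun i => x (Sum.inl i)) * (F₂ (fun i => x (Sum.inr i)) * exp (-V₂ (fun i => x (Sum.inr i))))) *
            (exp (x ⬝ᵥ (Matrix.fromBlocks (Q₁ + T) 0 0 (0 : Matrix n₂ n₂ ℝ) *ᵥ x)) *
              exp (-(x ⬝ᵥ (Matrix.fromBlocks S₁₁ S₁₂ S₁₂ᵀ S₂₂ *ᵥ x))))) := by
          rw [etilt]; ring
  · have hb : 0 ≤ (G₁ (fun i => x (Sum.inl i)) * (F₂ (fun i => x (Sum.inr i)) * exp (-V₂ (fun i => x (Sum.inr i))))) *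
        exp (-(x ⬝ᵥ (Matrix.fromBlocks S₁₁ S₁₂ S₁₂ᵀ S₂₂ *ᵥ x))) := mul_nonneg (mul_nonneg (hG₁ _) (hF₂' _)) (exp_pos _).le
    have hs := le_mul_exp_neg_of_small (V := V₁ x) (v := vp) hb fun hne => hsmall x
      (fun h0 => hne (by rw [h0, zero_mul, zero_mul])) (fun h0 => hne (by rw [h0, zero_mul, mul_zero, zero_mul]))
    have hrest : 0 ≤ (F₂ (fun i => x (Sum.inr i)) * exp (-V₂ (fun i => x (Sum.inr i)))) *
        exp (-(x ⬝ᵥ (Matrix.fromBlocks S₁₁ S₁₂ S₁₂ᵀ S₂₂ *ᵥ x))) * exp (-V₁ x) :=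
      mul_nonneg (mul_nonneg (hF₂' _) (exp_pos _).le) (exp_pos _).le
    calc (G₁ (fun i => x (Sum.inl i)) * (F₂ (fun i => x (Sum.inr i)) * exp (-V₂ (fun i => x (Sum.inr i))))) *
          exp (-(x ⬝ᵥ (Matrix.fromBlocks S₁₁ S₁₂ S₁₂ᵀ S₂₂ *ᵥ x)))
        ≤ exp vp * ((G₁ (fun i => x (Sum.inl i)) * (F₂ (fun i => x (Sum.inr i)) * exp (-V₂ (fun i => x (Sum.inr i))))) *
            exp (-(x ⬝ᵥ (Matrix.fromBlocks S₁₁ S₁₂ S₁₂ᵀ S₂₂ *ᵥ x))) * exp (-V₁ x)) := hs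
      _ = exp vp * (G₁ (fun i => x (Sum.inl i)) * ((F₂ (fun i => x (Sum.inr i)) * exp (-V₂ (fun i => x (Sum.inr i)))) *
            exp (-(x ⬝ᵥ (Matrix.fromBlocks S₁₁ S₁₂ S₁₂ᵀ S₂₂ *ᵥ x))) * exp (-V₁ x))) := by ring
      _ ≤ exp vp * (D₁ (fun i => x (Sum.inl i)) * ((F₂ (fun i => x (Sum.inr i)) * exp (-V₂ (fun i => x (Sum.inr i)))) *
            exp (-(x ⬝ᵥ (Matrix.fromBlocks S₁₁ S₁₂ S₁₂ᵀ S₂₂ *ᵥ x))) * exp (-V₁ x))) :=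
          mul_le_mul_of_nonneg_left (mul_le_mul_of_nonneg_right (hGD _) hrest) (exp_pos _).le
      _ = exp vp * ((D₁ (fun i => x (Sum.inl i)) * F₂ (fun i => x (Sum.inr i))) *
            (exp (-(x ⬝ᵥ (Matrix.fromBlocks S₁₁ S₁₂ S₁₂ᵀ S₂₂ *ᵥ x))) * exp (-(V₁ x + V₂ (fun i => x (Sum.inr i)))))) := by
          rw [exp_neg_add]; ring

end RelStabilityForm

end Summit.QuantumFields.BalabanUV.T4Continuum.NE7b.RelativeStabilitySandwich
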